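import Summits.QuantumFields.YangMills.Theorems.UnitScaleTiltProp7GreenOneBlockDecayOfLetters
import Summits.QuantumFields.YangMills.Theorems.UnitScaleTiltProp7GreenPiBlockLettersEdition
import HarnessLib

/-!
# Route `UnitScaleTilt`, crux K1 «MinimiserStabilityRegPr» (stmt-QuantumFields-19200), EX rows `norm_H₁`∕`hCk`∕`h137kΔ` (J-slot) — N6-J FILE E4: **`G₁ − G₀` HAS SMALL DECAYING ROWS**
# (the J-slot twin of ★p1 g27's ✓D4 `…GreenPiMinusEtaBlockDecay`; the `hΔb` letter of px10's slot-generic cone ✓`Prop7KinvSlotOfCone` at `Δx := DeltaOneP … a T_J`, i.e. of `hKinv`(Δ₁))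

Cell `ym3-torus` (HUMAN RULING D-0037; rung R3 = SU(2) YM₃ on T³ — NOT d = 4, NOT infinite volume, NOT a mass gap, NOT Clay).  Width seat `ym3-torus-px10` (gen 14; FREE px; CLAIM
2026-08-30 13:11Z).  THEOREMS ONLY (0 `def`, 0 `sorry`; ONE decl-local `maxHeartbeats 400000` on the main theorem — ✓E1's disclosed pattern, the `set`-heavy assembly times out at 200k;
every other decl at default); `--supports stmt-QuantumFields-19200 --as helper`; count-neutral.
THE MATHEMATICS.  px17's identity ✓`GT_one_eq_six_terms` `u := G₁f = G₀f + G₀(Δ^η(Dλ₁)) + (Dλ₂ − G₀(Δ^η(Dλ₂))) − G₀(T_J(Pᴾu)) + (Dλ₃ − G₀(Δ^η(Dλ₃)))`; ✓E1's decayed rows of `u`, `D*u`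
(`2(BV+BD)·s·e^{−δ·dc}`) fed back into the FIVE correction terms through the weighted letters (D2's five + E1's `hTw hTDw`) and ✓D1's local multipliers bound `u − G₀f`, `D*(u − G₀f)` by
`κ_V = 2(BV+BD)·[2α(1+e^{4δ})C₁BV + (1+C₂)·((6α(1+e^{4δ}) + C_TD)·C₃·(C₂ + 2α(1+e^{4δ})C₁BV) + C_T·BV)]` and `κ_D` (inner `BV ↦ BD`, bracket's leading `C₂ ↦ 1`) — `O(α) + O(C_T) + O(C_TD)`.
WHAT IS PROVED (ns `Summit.QuantumFields.YangMills.Theorems.Prop7GreenOneMinusEtaBlockDecay`).  `pointwise_of_five_terms` · ★★★ `blockDecay_rows_GTone_sub_GTeta_of_letters` (E1's binders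
VERBATIM ⟹ the two difference rows) · ★★★ `hDelta_one_of_letters` (the cone's `hΔb` TEXT at `Δx := DeltaOneP … a TJ` — ✓`kinvRow_slot_of_kinvRow_eta_of_cone`'s binder — from the seven
weighted letters `∀ z`) · ★★★ `hDelta_one_of_blockLetters` (the same from E2's SEVEN BLOCK letters (Gb)(Db)(c1b)(c2b)(c3b)(Tb)(TDb) VERBATIM, rate `δ₁ ≥ δ + ν`, constants `×V`, E2's window
VERBATIM — ONE window serves `hGblk`(Δ₁) AND `hΔb`(Δ₁)).  HONEST SCOPE.  Bookkeeping over displayed letters (suppliers as E1∕E2); nothing of `hKinv`(Δ₁), `norm_H₁`, `hCk`, EX or the crux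
is proved; the Yang–Mills mass gap is NOT proved.

References: T. Bałaban, CMP **99** (1985) 389–434 [Balaban1985BackgroundPropagators] ((3.42) p.397, (3.122) p.420, (3.128)–(3.131) pp.421–422, (3.134)–(3.138) pp.422–423, Thm 3.12 p.423).
-/

set_option autoImplicit false

noncomputable section

open scoped Matrix.Norms.L2Operator BigOperators InnerProductSpace ComplexConjugate
open Complex (I)

namespace Summit.QuantumFields.YangMills.Theorems.Prop7GreenOneMinusEtaBlockDecay

open Literature.MathematicalPhysics.QuantumFieldTheory.Balaban1983to89
open Literature.MathematicalPhysics.QuantumFieldTheory.Balaban1983to89.T3ContinuumYM3Torus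
open T3PrintedRegularMinimiser (RegPr)
open T3SectALandauChart (formComp bgUnits eta eta_pos)
open B5Eq118OneStroke (iterBlockOf)
open B9Eq311L2Pairing (WL2)
open B11Eq103H1Complex (SiteL2K BondL2K)
open Summit.QuantumFields.YangMills.Theorems.Prop7SectET3Transport (periodsT3)
open Summit.QuantumFields.YangMills.Theorems.Prop7SectET3HilbertLetters (W₂ toL2 toL2S DL2 DstarL2 covLapSite)
open Summit.QuantumFields.YangMills.Theorems.Prop7SectET3GaugeProjector (NS RS RS_RS)
open Summit.QuantumFields.YangMills.Theorems.Prop7SectET3WilsonHessian (DeltaEta DeltaEtaSlot)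
open Summit.QuantumFields.YangMills.Theorems.Prop7SectET3CurvedPropagators (PosOnto GT)
open Summit.QuantumFields.YangMills.Theorems.Prop7SectET3DeltaPiPInv (GprimeP gaugeCorrP gaugeCorrP_apply)
open Summit.QuantumFields.YangMills.Theorems.Prop7SectET3DeltaOnePInv (DeltaOneP)
open Summit.QuantumFields.YangMills.Theorems.Prop7DeltaPiDefectPairing (norm_J_one_le_of_regPr)
open Summit.QuantumFields.YangMills.Theorems.Prop7GreenPiSupRowsOfLetters (covLapSite_lambda₂)
open Summit.QuantumFields.YangMills.Theorems.Prop7GreenOneSupRowsOfLetters (GT_one_eq_six_terms)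
open Summit.QuantumFields.YangMills.Theorems.Prop7GreenPiBlockDecayLocal (DeltaEta_DL2_decay DstarL2_DeltaEta_decay)
open Summit.QuantumFields.YangMills.Theorems.Prop7GreenPiBlockLettersEdition (weighted_of_blockSupported)
open Summit.QuantumFields.YangMills.Theorems.Prop7GreenOneBlockDecayOfLetters (blockDecay_rows_GTone_of_letters)

variable {F : T3Family} {n K : ℕ} {h : n ≤ K} {c₀ cB a : ℝ}

section Abstract

variable [Fact (0 < c₀)]

/-- **POINTWISE ASSEMBLY OF THE FIVE CORRECTION TERMS**: if `u = G₀f + G₀A₁ + (Dl₂ − G₀A₂) − G₀B + (Dl₃ − G₀A₃)` then `u − G₀f` and `D*(u − G₀f)` are bounded at a point by the sum of the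
bounds of the five pieces there (abstract vectors). [folklore] -/
theorem pointwise_of_five_terms (G₀ : BondL2K ℂ 3 (periodsT3 F K) c₀ W₂ →ₗ[ℂ] BondL2K ℂ 3 (periodsT3 F K) c₀ W₂) (U₀ : GaugeField (F.P K) 0 (Matrix.specialUnitaryGroup (Fin 2) ℂ))
    (u f A₁ A₂ Dl₂ B Dl₃ A₃ : BondL2K ℂ 3 (periodsT3 F K) c₀ W₂) (h6 : u = G₀ f + G₀ A₁ + (Dl₂ - G₀ A₂) - G₀ B + (Dl₃ - G₀ A₃))
    (b₀ : PBond (F.P K) 0) (x₀ : Site (F.P K) 0)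
    {a₁ a₂ a₃ a₄ a₅ a₆ d₁ d₂ d₃ d₄ d₅ d₆ : ℝ}
    (hV₁ : ‖(toL2 F K c₀).symm (G₀ A₁) b₀‖ ≤ a₁) (hDl₂ : ‖(toL2 F K c₀).symm Dl₂ b₀‖ ≤ a₂) (hV₂ : ‖(toL2 F K c₀).symm (G₀ A₂) b₀‖ ≤ a₃)
    (hVB : ‖(toL2 F K c₀).symm (G₀ B) b₀‖ ≤ a₄) (hDl₃ : ‖(toL2 F K c₀).symm Dl₃ b₀‖ ≤ a₅) (hV₃ : ‖(toL2 F K c₀).symm (G₀ A₃) b₀‖ ≤ a₆)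
    (hD₁ : ‖(toL2S F K c₀).symm (DstarL2 F n K c₀ U₀ (G₀ A₁)) x₀‖ ≤ d₁) (hDDl₂ : ‖(toL2S F K c₀).symm (DstarL2 F n K c₀ U₀ Dl₂) x₀‖ ≤ d₂)
    (hD₂ : ‖(toL2S F K c₀).symm (DstarL2 F n K c₀ U₀ (G₀ A₂)) x₀‖ ≤ d₃) (hDB : ‖(toL2S F K c₀).symm (DstarL2 F n K c₀ U₀ (G₀ B)) x₀‖ ≤ d₄)
    (hDDl₃ : ‖(toL2S F K c₀).symm (DstarL2 F n K c₀ U₀ Dl₃) x₀‖ ≤ d₅) (hD₃ : ‖(toL2S F K c₀).symm (DstarL2 F n K c₀ U₀ (G₀ A₃)) x₀‖ ≤ d₆) :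
    ‖(toL2 F K c₀).symm (u - G₀ f) b₀‖ ≤ a₁ + (a₂ + a₃) + a₄ + (a₅ + a₆) ∧
      ‖(toL2S F K c₀).symm (DstarL2 F n K c₀ U₀ (u - G₀ f)) x₀‖ ≤ d₁ + (d₂ + d₃) + d₄ + (d₅ + d₆) := by
  have e : u - G₀ f = G₀ A₁ + (Dl₂ - G₀ A₂) - G₀ B + (Dl₃ - G₀ A₃) := by rw [h6]; abel
  rw [e]; constructor
  · simp only [map_add, map_sub, Pi.add_apply, Pi.sub_apply]
    exact (norm_add_le _ _).trans (add_le_add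
      ((norm_sub_le _ _).trans (add_le_add ((norm_add_le _ _).trans (add_le_add hV₁ ((norm_sub_le _ _).trans (add_le_add hDl₂ hV₂)))) hVB))
      ((norm_sub_le _ _).trans (add_le_add hDl₃ hV₃)))
  · simp only [map_add, map_sub, Pi.add_apply, Pi.sub_apply]
    exact (norm_add_le _ _).trans (add_le_add
      ((norm_sub_le _ _).trans (add_le_add ((norm_add_le _ _).trans (add_le_add hD₁ ((norm_sub_le _ _).trans (add_le_add hDDl₂ hD₂)))) hDB))
      ((norm_sub_le _ _).trans (add_le_add hDDl₃ hD₃)))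

end Abstract

/-! ## The rows of `G₁ − G₀` -/

section Rows

variable [Fact (0 < c₀)] [Fact (0 < cB)]
  (TJ : GaugeField (F.P K) 0 (Matrix.specialUnitaryGroup (Fin 2) ℂ) → (BondL2K ℂ 3 (periodsT3 F K) c₀ W₂ →ₗ[ℂ] BondL2K ℂ 3 (periodsT3 F K) c₀ W₂))

set_option maxHeartbeats 400000 in
/-- ★★★ **`G₁ − G₀` HAS SMALL DECAYING ROWS** (the N6-J input of the cone route to `hKinv`(Δ₁)).  Same data as ✓E1 `blockDecay_rows_GTone_of_letters` VERBATIM: for every `X` supported on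
the bonds of block `z` with `‖X b‖ ≤ s`, `‖toL2⁻¹(G₁(toL2 X) − G₀(toL2 X)) bd‖ ≤ κ_V·s·e^{−δ·dc(B bd₋, z)}` and `‖toL2S⁻¹(D*(G₁(toL2 X) − G₀(toL2 X))) x‖ ≤ κ_D·s·e^{−δ·dc(B x, z)}`,
`κ_V`, `κ_D` as in the header — `O(α) + O(C_T) + O(C_TD)`. [cite: Balaban1985BackgroundPropagators, (3.122) p.420, (3.128)–(3.131) pp.421–422, (3.136)–(3.138) p.423] -/
theorem blockDecay_rows_GTone_sub_GTeta_of_letters {α δ : ℝ} (hδ : 0 ≤ δ) (U₀ : GaugeField (F.P K) 0 (Matrix.specialUnitaryGroup (Fin 2) ℂ)) (hreg : RegPr F n K α U₀) (ha : 0 ≤ a)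
    (hp₀ : PosOnto F n K h c₀ cB a (DeltaEtaSlot F n K c₀) U₀) (hp₁ : PosOnto F n K h c₀ cB a (DeltaOneP F n K h c₀ cB a TJ) U₀)
    (z : Site (F.P K) (K - n)) {BV BD C₁ C₂ C₃ CT CTD : ℝ} (hBV : 0 ≤ BV) (hBD : 0 ≤ BD) (hC₁ : 0 ≤ C₁) (hC₂ : 0 ≤ C₂) (hC₃ : 0 ≤ C₃) (hCT : 0 ≤ CT) (hCTD : 0 ≤ CTD)
    (hGw : ∀ (Y : PBond (F.P K) 0 → Matrix (Fin 2) (Fin 2) ℂ) (m : ℝ), 0 ≤ m →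
      (∀ b, ‖Y b‖ ≤ m * Real.exp (-(δ * (Site.tdist (iterBlockOf (K - n) b.src) z : ℝ)))) →
      ∀ bd, ‖(toL2 F K c₀).symm (GT F n K h c₀ cB a (DeltaEtaSlot F n K c₀) U₀ (toL2 F K c₀ Y)) bd‖
        ≤ BV * m * Real.exp (-(δ * (Site.tdist (iterBlockOf (K - n) bd.src) z : ℝ))))
    (hDw : ∀ (Y : PBond (F.P K) 0 → Matrix (Fin 2) (Fin 2) ℂ) (m : ℝ), 0 ≤ m →
      (∀ b, ‖Y b‖ ≤ m * Real.exp (-(δ * (Site.tdist (iterBlockOf (K - n) b.src) z : ℝ)))) →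
      ∀ x, ‖(toL2S F K c₀).symm (DstarL2 F n K c₀ U₀ (GT F n K h c₀ cB a (DeltaEtaSlot F n K c₀) U₀ (toL2 F K c₀ Y))) x‖
        ≤ BD * m * Real.exp (-(δ * (Site.tdist (iterBlockOf (K - n) x) z : ℝ))))
    (hc1w : ∀ (v : Site (F.P K) 0 → Matrix (Fin 2) (Fin 2) ℂ) (m : ℝ), 0 ≤ m →
      (∀ y, ‖v y‖ ≤ m * Real.exp (-(δ * (Site.tdist (iterBlockOf (K - n) y) z : ℝ)))) →
      ∀ y, ‖(toL2S F K c₀).symm (GprimeP F n K h c₀ cB a U₀ (RS F n K h c₀ cB U₀ (toL2S F K c₀ v))) y‖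
        ≤ C₁ * m * Real.exp (-(δ * (Site.tdist (iterBlockOf (K - n) y) z : ℝ))))
    (hc2w : ∀ (v : Site (F.P K) 0 → Matrix (Fin 2) (Fin 2) ℂ) (m : ℝ), 0 ≤ m →
      (∀ y, ‖v y‖ ≤ m * Real.exp (-(δ * (Site.tdist (iterBlockOf (K - n) y) z : ℝ)))) →
      ∀ b, ‖(toL2 F K c₀).symm (DL2 F n K c₀ U₀ (GprimeP F n K h c₀ cB a U₀ (RS F n K h c₀ cB U₀ (toL2S F K c₀ v)))) b‖
        ≤ C₂ * m * Real.exp (-(δ * (Site.tdist (iterBlockOf (K - n) b.src) z : ℝ))))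
    (hc3w : ∀ (v : Site (F.P K) 0 → Matrix (Fin 2) (Fin 2) ℂ) (m : ℝ), 0 ≤ m →
      (∀ y, ‖v y‖ ≤ m * Real.exp (-(δ * (Site.tdist (iterBlockOf (K - n) y) z : ℝ)))) →
      ∀ y, ‖(toL2S F K c₀).symm (RS F n K h c₀ cB U₀ (GprimeP F n K h c₀ cB a U₀ (toL2S F K c₀ v))) y‖
        ≤ C₃ * m * Real.exp (-(δ * (Site.tdist (iterBlockOf (K - n) y) z : ℝ))))
    (hTw : ∀ (Y : PBond (F.P K) 0 → Matrix (Fin 2) (Fin 2) ℂ) (m : ℝ), 0 ≤ m →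
      (∀ b, ‖Y b‖ ≤ m * Real.exp (-(δ * (Site.tdist (iterBlockOf (K - n) b.src) z : ℝ)))) →
      ∀ bd, ‖(toL2 F K c₀).symm (TJ U₀ (toL2 F K c₀ Y)) bd‖ ≤ CT * m * Real.exp (-(δ * (Site.tdist (iterBlockOf (K - n) bd.src) z : ℝ))))
    (hTDw : ∀ (Y : PBond (F.P K) 0 → Matrix (Fin 2) (Fin 2) ℂ) (m : ℝ), 0 ≤ m →
      (∀ b, ‖Y b‖ ≤ m * Real.exp (-(δ * (Site.tdist (iterBlockOf (K - n) b.src) z : ℝ)))) →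
      ∀ x, ‖(toL2S F K c₀).symm (DstarL2 F n K c₀ U₀ (TJ U₀ (toL2 F K c₀ Y))) x‖ ≤ CTD * m * Real.exp (-(δ * (Site.tdist (iterBlockOf (K - n) x) z : ℝ))))
    (hwin : 2 * (1 + Real.exp (4 * δ)) * α * C₁ * (BV + BD)
      + ((6 * α * (1 + Real.exp (4 * δ)) + CTD) * C₃ * (1 + C₂ + 2 * (1 + Real.exp (4 * δ)) * α * C₁ * (BV + BD)) + CT * (BV + BD)) * (1 + C₂) ≤ 1 / 2)
    (X : PBond (F.P K) 0 → Matrix (Fin 2) (Fin 2) ℂ) (hXz : ∀ b, X b ≠ 0 → iterBlockOf (K - n) b.src = z) {s : ℝ} (hs : 0 ≤ s) (hX : ∀ b, ‖X b‖ ≤ s) :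
    (∀ bd, ‖(toL2 F K c₀).symm (GT F n K h c₀ cB a (DeltaOneP F n K h c₀ cB a TJ) U₀ (toL2 F K c₀ X) - GT F n K h c₀ cB a (DeltaEtaSlot F n K c₀) U₀ (toL2 F K c₀ X)) bd‖
        ≤ 2 * (BV + BD) * (2 * α * (1 + Real.exp (4 * δ)) * C₁ * BV + (1 + C₂) * ((6 * α * (1 + Real.exp (4 * δ)) + CTD) * C₃ * (C₂ + 2 * α * (1 + Real.exp (4 * δ)) * C₁ * BV) + CT * BV)) * s * Real.exp (-(δ * (Site.tdist (iterBlockOf (K - n) bd.src) z : ℝ)))) ∧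
    (∀ x, ‖(toL2S F K c₀).symm (DstarL2 F n K c₀ U₀ (GT F n K h c₀ cB a (DeltaOneP F n K h c₀ cB a TJ) U₀ (toL2 F K c₀ X) - GT F n K h c₀ cB a (DeltaEtaSlot F n K c₀) U₀ (toL2 F K c₀ X))) x‖
        ≤ 2 * (BV + BD) * (2 * α * (1 + Real.exp (4 * δ)) * C₁ * BD + (1 + C₂) * ((6 * α * (1 + Real.exp (4 * δ)) + CTD) * C₃ * (1 + 2 * α * (1 + Real.exp (4 * δ)) * C₁ * BD) + CT * BD)) * s * Real.exp (-(δ * (Site.tdist (iterBlockOf (K - n) x) z : ℝ)))) := by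
  classical
  have hη : 0 < eta F n K := eta_pos F n K
  have hα : 0 ≤ α := by
    have hJ := norm_J_one_le_of_regPr U₀ hreg 0 (Classical.arbitrary _)
    have h0 : 0 * eta F n K ^ 3 ≤ α * eta F n K ^ 3 := by rw [zero_mul]; exact (norm_nonneg _).trans hJ
    exact le_of_mul_le_mul_right h0 (pow_pos hη 3)
  have hE4 : 0 ≤ 1 + Real.exp (4 * δ) := by positivity
  -- E1: the rows of `u = G₁f` and `D*u` themselves
  have hE1 := blockDecay_rows_GTone_of_letters TJ hδ U₀ hreg ha hp₀ hp₁ z hBV hBD hC₁ hC₂ hC₃ hCT hCTD hGw hDw hc1w hc2w hc3w hTw hTDw hwin X hXz hs hX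
  set N : ℝ := 2 * (BV + BD) * s with hN
  have hN0 : 0 ≤ N := by rw [hN]; positivity
  have h6 := GT_one_eq_six_terms TJ (h := h) (cB := cB) ha hp₀ hp₁ (toL2 F K c₀ X)
  set f := toL2 F K c₀ X with hf
  set u := GT F n K h c₀ cB a (DeltaOneP F n K h c₀ cB a TJ) U₀ f with hu
  set lam₁ := GprimeP F n K h c₀ cB a U₀ (RS F n K h c₀ cB U₀ (DstarL2 F n K c₀ U₀ u)) with hlam₁
  set j := DstarL2 F n K c₀ U₀ (DeltaEta F n K c₀ U₀ (gaugeCorrP F n K h c₀ cB a U₀ u)) with hj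
  set lam₂ := GprimeP F n K h c₀ cB a U₀ (RS F n K h c₀ cB U₀ (GprimeP F n K h c₀ cB a U₀ j)) with hlam₂
  set j₃ := DstarL2 F n K c₀ U₀ (TJ U₀ (gaugeCorrP F n K h c₀ cB a U₀ u)) with hj₃
  set lam₃ := GprimeP F n K h c₀ cB a U₀ (RS F n K h c₀ cB U₀ (GprimeP F n K h c₀ cB a U₀ j₃)) with hlam₃
  set G₀ := GT F n K h c₀ cB a (DeltaEtaSlot F n K c₀) U₀ with hG₀
  set V : Site (F.P K) 0 → Matrix (Fin 2) (Fin 2) ℂ := (toL2S F K c₀).symm (DstarL2 F n K c₀ U₀ u) with hVd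
  have hUb : ∀ b, ‖(toL2 F K c₀).symm u b‖ ≤ N * Real.exp (-(δ * (Site.tdist (iterBlockOf (K - n) b.src) z : ℝ))) := hE1.1
  have hVx : ∀ y, ‖V y‖ ≤ N * Real.exp (-(δ * (Site.tdist (iterBlockOf (K - n) y) z : ℝ))) := hE1.2
  have hVeq : toL2S F K c₀ V = DstarL2 F n K c₀ U₀ u := LinearEquiv.apply_symm_apply _ _
  have hlam₁V : lam₁ = GprimeP F n K h c₀ cB a U₀ (RS F n K h c₀ cB U₀ (toL2S F K c₀ V)) := by rw [hVeq]
  have hl₁ : ∀ y, ‖(toL2S F K c₀).symm lam₁ y‖ ≤ C₁ * N * Real.exp (-(δ * (Site.tdist (iterBlockOf (K - n) y) z : ℝ))) := fun y => by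
    rw [hlam₁V]; exact hc1w V N hN0 hVx y
  have hDl₁ : ∀ b, ‖(toL2 F K c₀).symm (DL2 F n K c₀ U₀ lam₁) b‖ ≤ C₂ * N * Real.exp (-(δ * (Site.tdist (iterBlockOf (K - n) b.src) z : ℝ))) := fun b => by
    rw [hlam₁V]; exact hc2w V N hN0 hVx b
  set Pu : PBond (F.P K) 0 → Matrix (Fin 2) (Fin 2) ℂ := (toL2 F K c₀).symm (gaugeCorrP F n K h c₀ cB a U₀ u) with hPu
  have hPu_le : ∀ b, ‖Pu b‖ ≤ (N + C₂ * N) * Real.exp (-(δ * (Site.tdist (iterBlockOf (K - n) b.src) z : ℝ))) := by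
    intro b
    have e : Pu b = (toL2 F K c₀).symm u b - (toL2 F K c₀).symm (DL2 F n K c₀ U₀ lam₁) b := by
      rw [hPu, gaugeCorrP_apply, map_sub, Pi.sub_apply]
    rw [e, add_mul]
    exact (norm_sub_le _ _).trans (add_le_add (hUb b) (hDl₁ b))
  have hPueq : toL2 F K c₀ Pu = gaugeCorrP F n K h c₀ cB a U₀ u := LinearEquiv.apply_symm_apply _ _
  have hP0 : 0 ≤ N + C₂ * N := by positivity
  have hjle : ∀ y, ‖(toL2S F K c₀).symm j y‖ ≤ 6 * α * (1 + Real.exp (4 * δ)) * (N + C₂ * N) * Real.exp (-(δ * (Site.tdist (iterBlockOf (K - n) y) z : ℝ))) := by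
    intro y
    rw [hj, ← hPueq]
    exact DstarL2_DeltaEta_decay hδ U₀ hreg Pu z hP0 hPu_le y
  have hJ0 : 0 ≤ 6 * α * (1 + Real.exp (4 * δ)) * (N + C₂ * N) := by positivity
  set Jv : Site (F.P K) 0 → Matrix (Fin 2) (Fin 2) ℂ := (toL2S F K c₀).symm j with hJv
  have hJveq : toL2S F K c₀ Jv = j := LinearEquiv.apply_symm_apply _ _
  set g₂ := RS F n K h c₀ cB U₀ (GprimeP F n K h c₀ cB a U₀ j) with hg₂
  have hg₂le : ∀ y, ‖(toL2S F K c₀).symm g₂ y‖ ≤ C₃ * (6 * α * (1 + Real.exp (4 * δ)) * (N + C₂ * N)) * Real.exp (-(δ * (Site.tdist (iterBlockOf (K - n) y) z : ℝ))) :=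
    fun y => by rw [hg₂, ← hJveq]; exact hc3w Jv _ hJ0 hjle y
  have hG20 : 0 ≤ C₃ * (6 * α * (1 + Real.exp (4 * δ)) * (N + C₂ * N)) := by positivity
  set Gv : Site (F.P K) 0 → Matrix (Fin 2) (Fin 2) ℂ := (toL2S F K c₀).symm g₂ with hGv
  have hGveq : toL2S F K c₀ Gv = g₂ := LinearEquiv.apply_symm_apply _ _
  have hlam₂G : lam₂ = GprimeP F n K h c₀ cB a U₀ (RS F n K h c₀ cB U₀ (toL2S F K c₀ Gv)) := by rw [hGveq, hg₂, RS_RS]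
  have hl₂ : ∀ y, ‖(toL2S F K c₀).symm lam₂ y‖ ≤ C₁ * (C₃ * (6 * α * (1 + Real.exp (4 * δ)) * (N + C₂ * N))) * Real.exp (-(δ * (Site.tdist (iterBlockOf (K - n) y) z : ℝ))) :=
    fun y => by rw [hlam₂G]; exact hc1w Gv _ hG20 hg₂le y
  have hDl₂ : ∀ b, ‖(toL2 F K c₀).symm (DL2 F n K c₀ U₀ lam₂) b‖ ≤ C₂ * (C₃ * (6 * α * (1 + Real.exp (4 * δ)) * (N + C₂ * N))) * Real.exp (-(δ * (Site.tdist (iterBlockOf (K - n) b.src) z : ℝ))) :=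
    fun b => by rw [hlam₂G]; exact hc2w Gv _ hG20 hg₂le b
  have hsrc : ∀ (lam : SiteL2K ℂ 3 (periodsT3 F K) c₀ W₂) (m : ℝ), 0 ≤ m →
      (∀ y, ‖(toL2S F K c₀).symm lam y‖ ≤ m * Real.exp (-(δ * (Site.tdist (iterBlockOf (K - n) y) z : ℝ)))) →
      ∀ b, ‖(toL2 F K c₀).symm (DeltaEta F n K c₀ U₀ (DL2 F n K c₀ U₀ lam)) b‖ ≤ 2 * α * (1 + Real.exp (4 * δ)) * m * Real.exp (-(δ * (Site.tdist (iterBlockOf (K - n) b.src) z : ℝ))) := by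
    intro lam m hm0 hm b
    have e : lam = toL2S F K c₀ ((toL2S F K c₀).symm lam) := (LinearEquiv.apply_symm_apply _ _).symm
    rw [e]
    exact DeltaEta_DL2_decay hδ U₀ hreg _ z hm0 hm b
  have hS₁ := hsrc lam₁ (C₁ * N) (by positivity) hl₁
  have hS₂ := hsrc lam₂ (C₁ * (C₃ * (6 * α * (1 + Real.exp (4 * δ)) * (N + C₂ * N)))) (by positivity) hl₂
  have hread : ∀ y : BondL2K ℂ 3 (periodsT3 F K) c₀ W₂, y = toL2 F K c₀ ((toL2 F K c₀).symm y) := fun y => (LinearEquiv.apply_symm_apply _ _).symm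
  have hV₁ : ∀ b, ‖(toL2 F K c₀).symm (G₀ (DeltaEta F n K c₀ U₀ (DL2 F n K c₀ U₀ lam₁))) b‖
      ≤ BV * (2 * α * (1 + Real.exp (4 * δ)) * (C₁ * N)) * Real.exp (-(δ * (Site.tdist (iterBlockOf (K - n) b.src) z : ℝ))) := fun b => by
    rw [hread (DeltaEta F n K c₀ U₀ (DL2 F n K c₀ U₀ lam₁))]; exact hGw _ _ (by positivity) hS₁ b
  have hV₂ : ∀ b, ‖(toL2 F K c₀).symm (G₀ (DeltaEta F n K c₀ U₀ (DL2 F n K c₀ U₀ lam₂))) b‖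
      ≤ BV * (2 * α * (1 + Real.exp (4 * δ)) * (C₁ * (C₃ * (6 * α * (1 + Real.exp (4 * δ)) * (N + C₂ * N))))) * Real.exp (-(δ * (Site.tdist (iterBlockOf (K - n) b.src) z : ℝ))) :=
    fun b => by rw [hread (DeltaEta F n K c₀ U₀ (DL2 F n K c₀ U₀ lam₂))]; exact hGw _ _ (by positivity) hS₂ b
  have hD₁ : ∀ y, ‖(toL2S F K c₀).symm (DstarL2 F n K c₀ U₀ (G₀ (DeltaEta F n K c₀ U₀ (DL2 F n K c₀ U₀ lam₁)))) y‖
      ≤ BD * (2 * α * (1 + Real.exp (4 * δ)) * (C₁ * N)) * Real.exp (-(δ * (Site.tdist (iterBlockOf (K - n) y) z : ℝ))) := fun y => by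
    rw [hread (DeltaEta F n K c₀ U₀ (DL2 F n K c₀ U₀ lam₁))]; exact hDw _ _ (by positivity) hS₁ y
  have hD₂ : ∀ y, ‖(toL2S F K c₀).symm (DstarL2 F n K c₀ U₀ (G₀ (DeltaEta F n K c₀ U₀ (DL2 F n K c₀ U₀ lam₂)))) y‖
      ≤ BD * (2 * α * (1 + Real.exp (4 * δ)) * (C₁ * (C₃ * (6 * α * (1 + Real.exp (4 * δ)) * (N + C₂ * N))))) * Real.exp (-(δ * (Site.tdist (iterBlockOf (K - n) y) z : ℝ))) :=
    fun y => by rw [hread (DeltaEta F n K c₀ U₀ (DL2 F n K c₀ U₀ lam₂))]; exact hDw _ _ (by positivity) hS₂ y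
  have hDDl₂ : ∀ y, ‖(toL2S F K c₀).symm (DstarL2 F n K c₀ U₀ (DL2 F n K c₀ U₀ lam₂)) y‖
      ≤ C₃ * (6 * α * (1 + Real.exp (4 * δ)) * (N + C₂ * N)) * Real.exp (-(δ * (Site.tdist (iterBlockOf (K - n) y) z : ℝ))) := fun y => by
    rw [hlam₂, covLapSite_lambda₂ (h := h) (cB := cB) ha U₀ j]; exact hg₂le y
  -- the `T_J` word: `B = T_J(Pᴾu)`, `j₃ = D*B`, `g₃ = R_S(G′ᴾ j₃)`, `λ₃ = G′ᴾR_S g₃`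
  have hB : ∀ b, ‖(toL2 F K c₀).symm (TJ U₀ (gaugeCorrP F n K h c₀ cB a U₀ u)) b‖ ≤ CT * (N + C₂ * N) * Real.exp (-(δ * (Site.tdist (iterBlockOf (K - n) b.src) z : ℝ))) := fun b => by
    rw [← hPueq]; exact hTw Pu _ hP0 hPu_le b
  have hj₃le : ∀ y, ‖(toL2S F K c₀).symm j₃ y‖ ≤ CTD * (N + C₂ * N) * Real.exp (-(δ * (Site.tdist (iterBlockOf (K - n) y) z : ℝ))) := fun y => by
    rw [hj₃, ← hPueq]; exact hTDw Pu _ hP0 hPu_le y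
  have hJ30 : 0 ≤ CTD * (N + C₂ * N) := by positivity
  set Jv₃ : Site (F.P K) 0 → Matrix (Fin 2) (Fin 2) ℂ := (toL2S F K c₀).symm j₃ with hJv₃
  have hJv₃eq : toL2S F K c₀ Jv₃ = j₃ := LinearEquiv.apply_symm_apply _ _
  set g₃ := RS F n K h c₀ cB U₀ (GprimeP F n K h c₀ cB a U₀ j₃) with hg₃
  have hg₃le : ∀ y, ‖(toL2S F K c₀).symm g₃ y‖ ≤ C₃ * (CTD * (N + C₂ * N)) * Real.exp (-(δ * (Site.tdist (iterBlockOf (K - n) y) z : ℝ))) :=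
    fun y => by rw [hg₃, ← hJv₃eq]; exact hc3w Jv₃ _ hJ30 hj₃le y
  have hG30 : 0 ≤ C₃ * (CTD * (N + C₂ * N)) := by positivity
  set Gv₃ : Site (F.P K) 0 → Matrix (Fin 2) (Fin 2) ℂ := (toL2S F K c₀).symm g₃ with hGv₃
  have hGv₃eq : toL2S F K c₀ Gv₃ = g₃ := LinearEquiv.apply_symm_apply _ _
  have hlam₃G : lam₃ = GprimeP F n K h c₀ cB a U₀ (RS F n K h c₀ cB U₀ (toL2S F K c₀ Gv₃)) := by rw [hGv₃eq, hg₃, RS_RS]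
  have hl₃ : ∀ y, ‖(toL2S F K c₀).symm lam₃ y‖ ≤ C₁ * (C₃ * (CTD * (N + C₂ * N))) * Real.exp (-(δ * (Site.tdist (iterBlockOf (K - n) y) z : ℝ))) :=
    fun y => by rw [hlam₃G]; exact hc1w Gv₃ _ hG30 hg₃le y
  have hDl₃ : ∀ b, ‖(toL2 F K c₀).symm (DL2 F n K c₀ U₀ lam₃) b‖ ≤ C₂ * (C₃ * (CTD * (N + C₂ * N))) * Real.exp (-(δ * (Site.tdist (iterBlockOf (K - n) b.src) z : ℝ))) :=
    fun b => by rw [hlam₃G]; exact hc2w Gv₃ _ hG30 hg₃le b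
  have hS₃ := hsrc lam₃ (C₁ * (C₃ * (CTD * (N + C₂ * N)))) (by positivity) hl₃
  have hVB : ∀ b, ‖(toL2 F K c₀).symm (G₀ (TJ U₀ (gaugeCorrP F n K h c₀ cB a U₀ u))) b‖ ≤ BV * (CT * (N + C₂ * N)) * Real.exp (-(δ * (Site.tdist (iterBlockOf (K - n) b.src) z : ℝ))) := fun b => by
    rw [hread (TJ U₀ (gaugeCorrP F n K h c₀ cB a U₀ u))]; exact hGw _ _ (by positivity) hB b
  have hDB : ∀ y, ‖(toL2S F K c₀).symm (DstarL2 F n K c₀ U₀ (G₀ (TJ U₀ (gaugeCorrP F n K h c₀ cB a U₀ u)))) y‖ ≤ BD * (CT * (N + C₂ * N)) * Real.exp (-(δ * (Site.tdist (iterBlockOf (K - n) y) z : ℝ))) := fun y => by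
    rw [hread (TJ U₀ (gaugeCorrP F n K h c₀ cB a U₀ u))]; exact hDw _ _ (by positivity) hB y
  have hV₃ : ∀ b, ‖(toL2 F K c₀).symm (G₀ (DeltaEta F n K c₀ U₀ (DL2 F n K c₀ U₀ lam₃))) b‖
      ≤ BV * (2 * α * (1 + Real.exp (4 * δ)) * (C₁ * (C₃ * (CTD * (N + C₂ * N))))) * Real.exp (-(δ * (Site.tdist (iterBlockOf (K - n) b.src) z : ℝ))) := fun b => by
    rw [hread (DeltaEta F n K c₀ U₀ (DL2 F n K c₀ U₀ lam₃))]; exact hGw _ _ (by positivity) hS₃ b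
  have hD₃ : ∀ y, ‖(toL2S F K c₀).symm (DstarL2 F n K c₀ U₀ (G₀ (DeltaEta F n K c₀ U₀ (DL2 F n K c₀ U₀ lam₃)))) y‖
      ≤ BD * (2 * α * (1 + Real.exp (4 * δ)) * (C₁ * (C₃ * (CTD * (N + C₂ * N))))) * Real.exp (-(δ * (Site.tdist (iterBlockOf (K - n) y) z : ℝ))) := fun y => by
    rw [hread (DeltaEta F n K c₀ U₀ (DL2 F n K c₀ U₀ lam₃))]; exact hDw _ _ (by positivity) hS₃ y
  have hDDl₃ : ∀ y, ‖(toL2S F K c₀).symm (DstarL2 F n K c₀ U₀ (DL2 F n K c₀ U₀ lam₃)) y‖ ≤ C₃ * (CTD * (N + C₂ * N)) * Real.exp (-(δ * (Site.tdist (iterBlockOf (K - n) y) z : ℝ))) := fun y => by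
    rw [hlam₃, covLapSite_lambda₂ (h := h) (cB := cB) ha U₀ j₃]; exact hg₃le y
  -- assembly at every point (the six pieces named, so the identity matches syntactically)
  set A₁ := DeltaEta F n K c₀ U₀ (DL2 F n K c₀ U₀ lam₁) with hA₁
  set A₂ := DeltaEta F n K c₀ U₀ (DL2 F n K c₀ U₀ lam₂) with hA₂
  set Dl₂ := DL2 F n K c₀ U₀ lam₂ with hDl₂d
  set Bt := TJ U₀ (gaugeCorrP F n K h c₀ cB a U₀ u) with hBt
  set Dl₃ := DL2 F n K c₀ U₀ lam₃ with hDl₃d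
  set A₃ := DeltaEta F n K c₀ U₀ (DL2 F n K c₀ U₀ lam₃) with hA₃
  refine ⟨fun bd => ?_, fun x => ?_⟩
  · have hasm := (pointwise_of_five_terms (n := n) G₀ U₀ u f A₁ A₂ Dl₂ Bt Dl₃ A₃ h6 bd bd.src (hV₁ bd) (hDl₂ bd) (hV₂ bd) (hVB bd) (hDl₃ bd) (hV₃ bd)
      (hD₁ bd.src) (hDDl₂ bd.src) (hD₂ bd.src) (hDB bd.src) (hDDl₃ bd.src) (hD₃ bd.src)).1
    exact hasm.trans (le_of_eq (by rw [hN]; ring))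
  · have hasm := (pointwise_of_five_terms (n := n) G₀ U₀ u f A₁ A₂ Dl₂ Bt Dl₃ A₃ h6 ⟨x, 0⟩ x (hV₁ _) (hDl₂ _) (hV₂ _) (hVB _) (hDl₃ _) (hV₃ _)
      (hD₁ x) (hDDl₂ x) (hD₂ x) (hDB x) (hDDl₃ x) (hD₃ x)).2
    exact hasm.trans (le_of_eq (by rw [hN]; ring))

/-- ★★★ **THE CONE'S LETTER `hΔb` AT THE J-SLOT** (px10's slot-generic ✓`kinvRow_slot_of_kinvRow_eta_of_cone` at `Δx := DeltaOneP … a T_J`): the VALUE row of the LinearMap difference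
`GT_{Δ₁} − GT₀` on block-supported sources, binders `X z hXz s hs hX bd`, from the seven weighted letters quantified over the block. [cite: Balaban1985BackgroundPropagators, (3.122) p.420, (3.136)–(3.138) p.423] -/
theorem hDelta_one_of_letters {α δ : ℝ} (hδ : 0 ≤ δ) (U₀ : GaugeField (F.P K) 0 (Matrix.specialUnitaryGroup (Fin 2) ℂ)) (hreg : RegPr F n K α U₀) (ha : 0 ≤ a)
    (hp₀ : PosOnto F n K h c₀ cB a (DeltaEtaSlot F n K c₀) U₀) (hp₁ : PosOnto F n K h c₀ cB a (DeltaOneP F n K h c₀ cB a TJ) U₀)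
    {BV BD C₁ C₂ C₃ CT CTD : ℝ} (hBV : 0 ≤ BV) (hBD : 0 ≤ BD) (hC₁ : 0 ≤ C₁) (hC₂ : 0 ≤ C₂) (hC₃ : 0 ≤ C₃) (hCT : 0 ≤ CT) (hCTD : 0 ≤ CTD)
    (hGw : ∀ (z : Site (F.P K) (K - n)) (Y : PBond (F.P K) 0 → Matrix (Fin 2) (Fin 2) ℂ) (m : ℝ), 0 ≤ m →
      (∀ b, ‖Y b‖ ≤ m * Real.exp (-(δ * (Site.tdist (iterBlockOf (K - n) b.src) z : ℝ)))) →
      ∀ bd, ‖(toL2 F K c₀).symm (GT F n K h c₀ cB a (DeltaEtaSlot F n K c₀) U₀ (toL2 F K c₀ Y)) bd‖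
        ≤ BV * m * Real.exp (-(δ * (Site.tdist (iterBlockOf (K - n) bd.src) z : ℝ))))
    (hDw : ∀ (z : Site (F.P K) (K - n)) (Y : PBond (F.P K) 0 → Matrix (Fin 2) (Fin 2) ℂ) (m : ℝ), 0 ≤ m →
      (∀ b, ‖Y b‖ ≤ m * Real.exp (-(δ * (Site.tdist (iterBlockOf (K - n) b.src) z : ℝ)))) →
      ∀ x, ‖(toL2S F K c₀).symm (DstarL2 F n K c₀ U₀ (GT F n K h c₀ cB a (DeltaEtaSlot F n K c₀) U₀ (toL2 F K c₀ Y))) x‖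
        ≤ BD * m * Real.exp (-(δ * (Site.tdist (iterBlockOf (K - n) x) z : ℝ))))
    (hc1w : ∀ (z : Site (F.P K) (K - n)) (v : Site (F.P K) 0 → Matrix (Fin 2) (Fin 2) ℂ) (m : ℝ), 0 ≤ m →
      (∀ y, ‖v y‖ ≤ m * Real.exp (-(δ * (Site.tdist (iterBlockOf (K - n) y) z : ℝ)))) →
      ∀ y, ‖(toL2S F K c₀).symm (GprimeP F n K h c₀ cB a U₀ (RS F n K h c₀ cB U₀ (toL2S F K c₀ v))) y‖
        ≤ C₁ * m * Real.exp (-(δ * (Site.tdist (iterBlockOf (K - n) y) z : ℝ))))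
    (hc2w : ∀ (z : Site (F.P K) (K - n)) (v : Site (F.P K) 0 → Matrix (Fin 2) (Fin 2) ℂ) (m : ℝ), 0 ≤ m →
      (∀ y, ‖v y‖ ≤ m * Real.exp (-(δ * (Site.tdist (iterBlockOf (K - n) y) z : ℝ)))) →
      ∀ b, ‖(toL2 F K c₀).symm (DL2 F n K c₀ U₀ (GprimeP F n K h c₀ cB a U₀ (RS F n K h c₀ cB U₀ (toL2S F K c₀ v)))) b‖
        ≤ C₂ * m * Real.exp (-(δ * (Site.tdist (iterBlockOf (K - n) b.src) z : ℝ))))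
    (hc3w : ∀ (z : Site (F.P K) (K - n)) (v : Site (F.P K) 0 → Matrix (Fin 2) (Fin 2) ℂ) (m : ℝ), 0 ≤ m →
      (∀ y, ‖v y‖ ≤ m * Real.exp (-(δ * (Site.tdist (iterBlockOf (K - n) y) z : ℝ)))) →
      ∀ y, ‖(toL2S F K c₀).symm (RS F n K h c₀ cB U₀ (GprimeP F n K h c₀ cB a U₀ (toL2S F K c₀ v))) y‖
        ≤ C₃ * m * Real.exp (-(δ * (Site.tdist (iterBlockOf (K - n) y) z : ℝ))))
    (hTw : ∀ (z : Site (F.P K) (K - n)) (Y : PBond (F.P K) 0 → Matrix (Fin 2) (Fin 2) ℂ) (m : ℝ), 0 ≤ m →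
      (∀ b, ‖Y b‖ ≤ m * Real.exp (-(δ * (Site.tdist (iterBlockOf (K - n) b.src) z : ℝ)))) →
      ∀ bd, ‖(toL2 F K c₀).symm (TJ U₀ (toL2 F K c₀ Y)) bd‖ ≤ CT * m * Real.exp (-(δ * (Site.tdist (iterBlockOf (K - n) bd.src) z : ℝ))))
    (hTDw : ∀ (z : Site (F.P K) (K - n)) (Y : PBond (F.P K) 0 → Matrix (Fin 2) (Fin 2) ℂ) (m : ℝ), 0 ≤ m →
      (∀ b, ‖Y b‖ ≤ m * Real.exp (-(δ * (Site.tdist (iterBlockOf (K - n) b.src) z : ℝ)))) →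
      ∀ x, ‖(toL2S F K c₀).symm (DstarL2 F n K c₀ U₀ (TJ U₀ (toL2 F K c₀ Y))) x‖ ≤ CTD * m * Real.exp (-(δ * (Site.tdist (iterBlockOf (K - n) x) z : ℝ))))
    (hwin : 2 * (1 + Real.exp (4 * δ)) * α * C₁ * (BV + BD)
      + ((6 * α * (1 + Real.exp (4 * δ)) + CTD) * C₃ * (1 + C₂ + 2 * (1 + Real.exp (4 * δ)) * α * C₁ * (BV + BD)) + CT * (BV + BD)) * (1 + C₂) ≤ 1 / 2) :
    ∀ (X : PBond (F.P K) 0 → Matrix (Fin 2) (Fin 2) ℂ) (z : Site (F.P K) (K - n)), (∀ b, X b ≠ 0 → iterBlockOf (K - n) b.src = z) →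
      ∀ s : ℝ, 0 ≤ s → (∀ b, ‖X b‖ ≤ s) →
        ∀ bd : PBond (F.P K) 0, ‖(toL2 F K c₀).symm ((GT F n K h c₀ cB a (DeltaOneP F n K h c₀ cB a TJ) U₀ - GT F n K h c₀ cB a (DeltaEtaSlot F n K c₀) U₀) (toL2 F K c₀ X)) bd‖
          ≤ s * (2 * (BV + BD) * (2 * α * (1 + Real.exp (4 * δ)) * C₁ * BV + (1 + C₂) * ((6 * α * (1 + Real.exp (4 * δ)) + CTD) * C₃ * (C₂ + 2 * α * (1 + Real.exp (4 * δ)) * C₁ * BV) + CT * BV)))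
            * Real.exp (-(δ * (Site.tdist (P := F.P K) (iterBlockOf (K - n) bd.src) z : ℝ))) := by
  intro X z hXz s hs hX bd; have h1 := (blockDecay_rows_GTone_sub_GTeta_of_letters TJ hδ U₀ hreg ha hp₀ hp₁ z hBV hBD hC₁ hC₂ hC₃ hCT hCTD (hGw z) (hDw z) (hc1w z) (hc2w z) (hc3w z) (hTw z) (hTDw z)
    hwin X hXz hs hX).1 bd
  rw [LinearMap.sub_apply]; exact h1.trans (le_of_eq (by ring))

/-- ★★★ **THE CONE'S LETTER `hΔb` AT THE J-SLOT FROM SEVEN BLOCK-SUPPORTED LETTERS** (E2's binders (Gb)(Db)(c1b)(c2b)(c3b)(Tb)(TDb) VERBATIM at rate `δ₁ ≥ δ + ν`, constants `×V`,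
`V := (2(1+1∕ν))³`, E1's window in the `×V` constants = E2 `hGblk_one_of_blockLetters`' window VERBATIM): the same `hΔb` text with `κ_V(BV·V, BD·V, Cᵢ·V, C_T·V, C_TD·V)`.
[cite: Balaban1985BackgroundPropagators, (3.122) p.420, (3.47)–(3.49) pp.398–399, Thm 3.12 p.423] -/
theorem hDelta_one_of_blockLetters {α δ δ₁ ν : ℝ} (hδ : 0 ≤ δ) (hν : 0 < ν) (hδ₁ : δ + ν ≤ δ₁)
    (U₀ : GaugeField (F.P K) 0 (Matrix.specialUnitaryGroup (Fin 2) ℂ)) (hreg : RegPr F n K α U₀) (ha : 0 ≤ a)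
    (hp₀ : PosOnto F n K h c₀ cB a (DeltaEtaSlot F n K c₀) U₀) (hp₁ : PosOnto F n K h c₀ cB a (DeltaOneP F n K h c₀ cB a TJ) U₀)
    {BV BD C₁ C₂ C₃ CT CTD : ℝ} (hBV : 0 ≤ BV) (hBD : 0 ≤ BD) (hC₁ : 0 ≤ C₁) (hC₂ : 0 ≤ C₂) (hC₃ : 0 ≤ C₃) (hCT : 0 ≤ CT) (hCTD : 0 ≤ CTD)
    (hGb : ∀ (X : PBond (F.P K) 0 → Matrix (Fin 2) (Fin 2) ℂ) (z : Site (F.P K) (K - n)), (∀ b, X b ≠ 0 → iterBlockOf (K - n) b.src = z) →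
      ∀ s : ℝ, 0 ≤ s → (∀ b, ‖X b‖ ≤ s) →
        ∀ bd : PBond (F.P K) 0, ‖(toL2 F K c₀).symm (GT F n K h c₀ cB a (DeltaEtaSlot F n K c₀) U₀ (toL2 F K c₀ X)) bd‖ ≤ s * BV * Real.exp (-(δ₁ * (Site.tdist (P := F.P K) (iterBlockOf (K - n) bd.src) z : ℝ))))
    (hDb : ∀ (X : PBond (F.P K) 0 → Matrix (Fin 2) (Fin 2) ℂ) (z : Site (F.P K) (K - n)), (∀ b, X b ≠ 0 → iterBlockOf (K - n) b.src = z) →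
      ∀ s : ℝ, 0 ≤ s → (∀ b, ‖X b‖ ≤ s) →
        ∀ x : Site (F.P K) 0, ‖(toL2S F K c₀).symm (DstarL2 F n K c₀ U₀ (GT F n K h c₀ cB a (DeltaEtaSlot F n K c₀) U₀ (toL2 F K c₀ X))) x‖ ≤ s * BD * Real.exp (-(δ₁ * (Site.tdist (P := F.P K) (iterBlockOf (K - n) x) z : ℝ))))
    (hc1b : ∀ (v : Site (F.P K) 0 → Matrix (Fin 2) (Fin 2) ℂ) (z : Site (F.P K) (K - n)), (∀ y, v y ≠ 0 → iterBlockOf (K - n) y = z) →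
      ∀ m : ℝ, 0 ≤ m → (∀ y, ‖v y‖ ≤ m) →
        ∀ y : Site (F.P K) 0, ‖(toL2S F K c₀).symm (GprimeP F n K h c₀ cB a U₀ (RS F n K h c₀ cB U₀ (toL2S F K c₀ v))) y‖ ≤ m * C₁ * Real.exp (-(δ₁ * (Site.tdist (P := F.P K) (iterBlockOf (K - n) y) z : ℝ))))
    (hc2b : ∀ (v : Site (F.P K) 0 → Matrix (Fin 2) (Fin 2) ℂ) (z : Site (F.P K) (K - n)), (∀ y, v y ≠ 0 → iterBlockOf (K - n) y = z) →
      ∀ m : ℝ, 0 ≤ m → (∀ y, ‖v y‖ ≤ m) →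
        ∀ b : PBond (F.P K) 0, ‖(toL2 F K c₀).symm (DL2 F n K c₀ U₀ (GprimeP F n K h c₀ cB a U₀ (RS F n K h c₀ cB U₀ (toL2S F K c₀ v)))) b‖ ≤ m * C₂ * Real.exp (-(δ₁ * (Site.tdist (P := F.P K) (iterBlockOf (K - n) b.src) z : ℝ))))
    (hc3b : ∀ (v : Site (F.P K) 0 → Matrix (Fin 2) (Fin 2) ℂ) (z : Site (F.P K) (K - n)), (∀ y, v y ≠ 0 → iterBlockOf (K - n) y = z) →
      ∀ m : ℝ, 0 ≤ m → (∀ y, ‖v y‖ ≤ m) →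
        ∀ y : Site (F.P K) 0, ‖(toL2S F K c₀).symm (RS F n K h c₀ cB U₀ (GprimeP F n K h c₀ cB a U₀ (toL2S F K c₀ v))) y‖ ≤ m * C₃ * Real.exp (-(δ₁ * (Site.tdist (P := F.P K) (iterBlockOf (K - n) y) z : ℝ))))
    (hTb : ∀ (X : PBond (F.P K) 0 → Matrix (Fin 2) (Fin 2) ℂ) (z : Site (F.P K) (K - n)), (∀ b, X b ≠ 0 → iterBlockOf (K - n) b.src = z) →
      ∀ s : ℝ, 0 ≤ s → (∀ b, ‖X b‖ ≤ s) →
        ∀ bd : PBond (F.P K) 0, ‖(toL2 F K c₀).symm (TJ U₀ (toL2 F K c₀ X)) bd‖ ≤ s * CT * Real.exp (-(δ₁ * (Site.tdist (P := F.P K) (iterBlockOf (K - n) bd.src) z : ℝ))))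
    (hTDb : ∀ (X : PBond (F.P K) 0 → Matrix (Fin 2) (Fin 2) ℂ) (z : Site (F.P K) (K - n)), (∀ b, X b ≠ 0 → iterBlockOf (K - n) b.src = z) →
      ∀ s : ℝ, 0 ≤ s → (∀ b, ‖X b‖ ≤ s) →
        ∀ x : Site (F.P K) 0, ‖(toL2S F K c₀).symm (DstarL2 F n K c₀ U₀ (TJ U₀ (toL2 F K c₀ X))) x‖ ≤ s * CTD * Real.exp (-(δ₁ * (Site.tdist (P := F.P K) (iterBlockOf (K - n) x) z : ℝ))))
    (hwin : 2 * (1 + Real.exp (4 * δ)) * α * (C₁ * (2 * (1 + 1 / ν)) ^ 3) * ((BV * (2 * (1 + 1 / ν)) ^ 3) + (BD * (2 * (1 + 1 / ν)) ^ 3))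
      + ((6 * α * (1 + Real.exp (4 * δ)) + (CTD * (2 * (1 + 1 / ν)) ^ 3)) * (C₃ * (2 * (1 + 1 / ν)) ^ 3) * (1 + (C₂ * (2 * (1 + 1 / ν)) ^ 3) + 2 * (1 + Real.exp (4 * δ)) * α * (C₁ * (2 * (1 + 1 / ν)) ^ 3) * ((BV * (2 * (1 + 1 / ν)) ^ 3) + (BD * (2 * (1 + 1 / ν)) ^ 3))) + (CT * (2 * (1 + 1 / ν)) ^ 3) * ((BV * (2 * (1 + 1 / ν)) ^ 3) + (BD * (2 * (1 + 1 / ν)) ^ 3))) * (1 + (C₂ * (2 * (1 + 1 / ν)) ^ 3)) ≤ 1 / 2) :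
    ∀ (X : PBond (F.P K) 0 → Matrix (Fin 2) (Fin 2) ℂ) (z : Site (F.P K) (K - n)), (∀ b, X b ≠ 0 → iterBlockOf (K - n) b.src = z) →
      ∀ s : ℝ, 0 ≤ s → (∀ b, ‖X b‖ ≤ s) →
        ∀ bd : PBond (F.P K) 0, ‖(toL2 F K c₀).symm ((GT F n K h c₀ cB a (DeltaOneP F n K h c₀ cB a TJ) U₀ - GT F n K h c₀ cB a (DeltaEtaSlot F n K c₀) U₀) (toL2 F K c₀ X)) bd‖
          ≤ s * (2 * ((BV * (2 * (1 + 1 / ν)) ^ 3) + (BD * (2 * (1 + 1 / ν)) ^ 3)) * (2 * α * (1 + Real.exp (4 * δ)) * (C₁ * (2 * (1 + 1 / ν)) ^ 3) * (BV * (2 * (1 + 1 / ν)) ^ 3) + (1 + (C₂ * (2 * (1 + 1 / ν)) ^ 3)) * ((6 * α * (1 + Real.exp (4 * δ)) + (CTD * (2 * (1 + 1 / ν)) ^ 3)) * (C₃ * (2 * (1 + 1 / ν)) ^ 3) * ((C₂ * (2 * (1 + 1 / ν)) ^ 3) + 2 * α * (1 + Real.exp (4 * δ)) * (C₁ * (2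 * (1 + 1 / ν)) ^ 3) * (BV * (2 * (1 + 1 / ν)) ^ 3)) + (CT * (2 * (1 + 1 / ν)) ^ 3) * (BV * (2 * (1 + 1 / ν)) ^ 3))))
            * Real.exp (-(δ * (Site.tdist (P := F.P K) (iterBlockOf (K - n) bd.src) z : ℝ))) := by
  have hV : 0 ≤ (2 * (1 + 1 / ν)) ^ 3 := by positivity
  have hΦG : ∀ f : Site (F.P K) (K - n) → PBond (F.P K) 0 → Matrix (Fin 2) (Fin 2) ℂ,
      (fun X bd => (toL2 F K c₀).symm (GT F n K h c₀ cB a (DeltaEtaSlot F n K c₀) U₀ (toL2 F K c₀ X)) bd) (∑ z, f z) = ∑ z, (fun X bd => (toL2 F K c₀).symm (GT F n K h c₀ cB a (DeltaEtaSlot F n K c₀) U₀ (toL2 F K c₀ X)) bd) (f z) := fun f => by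
    funext bd; simp only [map_sum, Finset.sum_apply]
  have hΦD : ∀ f : Site (F.P K) (K - n) → PBond (F.P K) 0 → Matrix (Fin 2) (Fin 2) ℂ,
      (fun X x => (toL2S F K c₀).symm (DstarL2 F n K c₀ U₀ (GT F n K h c₀ cB a (DeltaEtaSlot F n K c₀) U₀ (toL2 F K c₀ X))) x) (∑ z, f z) = ∑ z, (fun X x => (toL2S F K c₀).symm (DstarL2 F n K c₀ U₀ (GT F n K h c₀ cB a (DeltaEtaSlot F n K c₀) U₀ (toL2 F K c₀ X))) x) (f z) := fun f => by
    funext x; simp only [map_sum, Finset.sum_apply]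
  have hΦ1 : ∀ f : Site (F.P K) (K - n) → Site (F.P K) 0 → Matrix (Fin 2) (Fin 2) ℂ,
      (fun v y => (toL2S F K c₀).symm (GprimeP F n K h c₀ cB a U₀ (RS F n K h c₀ cB U₀ (toL2S F K c₀ v))) y) (∑ z, f z) = ∑ z, (fun v y => (toL2S F K c₀).symm (GprimeP F n K h c₀ cB a U₀ (RS F n K h c₀ cB U₀ (toL2S F K c₀ v))) y) (f z) := fun f => by
    funext y; simp only [map_sum, Finset.sum_apply]
  have hΦ2 : ∀ f : Site (F.P K) (K - n) → Site (F.P K) 0 → Matrix (Fin 2) (Fin 2) ℂ,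
      (fun v b => (toL2 F K c₀).symm (DL2 F n K c₀ U₀ (GprimeP F n K h c₀ cB a U₀ (RS F n K h c₀ cB U₀ (toL2S F K c₀ v)))) b) (∑ z, f z) = ∑ z, (fun v b => (toL2 F K c₀).symm (DL2 F n K c₀ U₀ (GprimeP F n K h c₀ cB a U₀ (RS F n K h c₀ cB U₀ (toL2S F K c₀ v)))) b) (f z) := fun f => by
    funext b; simp only [map_sum, Finset.sum_apply]
  have hΦ3 : ∀ f : Site (F.P K) (K - n) → Site (F.P K) 0 → Matrix (Fin 2) (Fin 2) ℂ,
      (fun v y => (toL2S F K c₀).symm (RS F n K h c₀ cB U₀ (GprimeP F n K h c₀ cB a U₀ (toL2S F K c₀ v))) y) (∑ z, f z) = ∑ z, (fun v y => (toL2S F K c₀).symm (RS F n K h c₀ cB U₀ (GprimeP F n K h c₀ cB a U₀ (toL2S F K c₀ v))) y) (f z) := fun f => by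
    funext y; simp only [map_sum, Finset.sum_apply]
  have hΦT : ∀ f : Site (F.P K) (K - n) → PBond (F.P K) 0 → Matrix (Fin 2) (Fin 2) ℂ,
      (fun X bd => (toL2 F K c₀).symm (TJ U₀ (toL2 F K c₀ X)) bd) (∑ z, f z) = ∑ z, (fun X bd => (toL2 F K c₀).symm (TJ U₀ (toL2 F K c₀ X)) bd) (f z) := fun f => by
    funext bd; simp only [map_sum, Finset.sum_apply]
  have hΦTD : ∀ f : Site (F.P K) (K - n) → PBond (F.P K) 0 → Matrix (Fin 2) (Fin 2) ℂ,
      (fun X x => (toL2S F K c₀).symm (DstarL2 F n K c₀ U₀ (TJ U₀ (toL2 F K c₀ X))) x) (∑ z, f z) = ∑ z, (fun X x => (toL2S F K c₀).symm (DstarL2 F n K c₀ U₀ (TJ U₀ (toL2 F K c₀ X))) x) (f z) := fun f => by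
    funext x; simp only [map_sum, Finset.sum_apply]
  have hGw := fun (z : Site (F.P K) (K - n)) (Y : PBond (F.P K) 0 → Matrix (Fin 2) (Fin 2) ℂ) (m : ℝ) (hm : 0 ≤ m)
      (hY : ∀ b, ‖Y b‖ ≤ m * Real.exp (-(δ * (Site.tdist (iterBlockOf (K - n) b.src) z : ℝ)))) (bd : PBond (F.P K) 0) =>
    weighted_of_blockSupported (fun b : PBond (F.P K) 0 => iterBlockOf (K - n) b.src) (fun bd : PBond (F.P K) 0 => iterBlockOf (K - n) bd.src) _ hΦG hBV hδ hν hδ₁ hGb z Y m hm hY bd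
  have hDw := fun (z : Site (F.P K) (K - n)) (Y : PBond (F.P K) 0 → Matrix (Fin 2) (Fin 2) ℂ) (m : ℝ) (hm : 0 ≤ m)
      (hY : ∀ b, ‖Y b‖ ≤ m * Real.exp (-(δ * (Site.tdist (iterBlockOf (K - n) b.src) z : ℝ)))) (x : Site (F.P K) 0) =>
    weighted_of_blockSupported (fun b : PBond (F.P K) 0 => iterBlockOf (K - n) b.src) (fun x : Site (F.P K) 0 => iterBlockOf (K - n) x) _ hΦD hBD hδ hν hδ₁ hDb z Y m hm hY x
  have hc1w := fun (z : Site (F.P K) (K - n)) (v : Site (F.P K) 0 → Matrix (Fin 2) (Fin 2) ℂ) (m : ℝ) (hm : 0 ≤ m)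
      (hv : ∀ y, ‖v y‖ ≤ m * Real.exp (-(δ * (Site.tdist (iterBlockOf (K - n) y) z : ℝ)))) (y : Site (F.P K) 0) =>
    weighted_of_blockSupported (fun y : Site (F.P K) 0 => iterBlockOf (K - n) y) (fun y : Site (F.P K) 0 => iterBlockOf (K - n) y) _ hΦ1 hC₁ hδ hν hδ₁ hc1b z v m hm hv y
  have hc2w := fun (z : Site (F.P K) (K - n)) (v : Site (F.P K) 0 → Matrix (Fin 2) (Fin 2) ℂ) (m : ℝ) (hm : 0 ≤ m)
      (hv : ∀ y, ‖v y‖ ≤ m * Real.exp (-(δ * (Site.tdist (iterBlockOf (K - n) y) z : ℝ)))) (b : PBond (F.P K) 0) =>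
    weighted_of_blockSupported (fun y : Site (F.P K) 0 => iterBlockOf (K - n) y) (fun b : PBond (F.P K) 0 => iterBlockOf (K - n) b.src) _ hΦ2 hC₂ hδ hν hδ₁ hc2b z v m hm hv b
  have hc3w := fun (z : Site (F.P K) (K - n)) (v : Site (F.P K) 0 → Matrix (Fin 2) (Fin 2) ℂ) (m : ℝ) (hm : 0 ≤ m)
      (hv : ∀ y, ‖v y‖ ≤ m * Real.exp (-(δ * (Site.tdist (iterBlockOf (K - n) y) z : ℝ)))) (y : Site (F.P K) 0) =>
    weighted_of_blockSupported (fun y : Site (F.P K) 0 => iterBlockOf (K - n) y) (fun y : Site (F.P K) 0 => iterBlockOf (K - n) y) _ hΦ3 hC₃ hδ hν hδ₁ hc3b z v m hm hv y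
  have hTw := fun (z : Site (F.P K) (K - n)) (Y : PBond (F.P K) 0 → Matrix (Fin 2) (Fin 2) ℂ) (m : ℝ) (hm : 0 ≤ m)
      (hY : ∀ b, ‖Y b‖ ≤ m * Real.exp (-(δ * (Site.tdist (iterBlockOf (K - n) b.src) z : ℝ)))) (bd : PBond (F.P K) 0) =>
    weighted_of_blockSupported (fun b : PBond (F.P K) 0 => iterBlockOf (K - n) b.src) (fun bd : PBond (F.P K) 0 => iterBlockOf (K - n) bd.src) _ hΦT hCT hδ hν hδ₁ hTb z Y m hm hY bd
  have hTDw := fun (z : Site (F.P K) (K - n)) (Y : PBond (F.P K) 0 → Matrix (Fin 2) (Fin 2) ℂ) (m : ℝ) (hm : 0 ≤ m)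
      (hY : ∀ b, ‖Y b‖ ≤ m * Real.exp (-(δ * (Site.tdist (iterBlockOf (K - n) b.src) z : ℝ)))) (x : Site (F.P K) 0) =>
    weighted_of_blockSupported (fun b : PBond (F.P K) 0 => iterBlockOf (K - n) b.src) (fun x : Site (F.P K) 0 => iterBlockOf (K - n) x) _ hΦTD hCTD hδ hν hδ₁ hTDb z Y m hm hY x
  exact hDelta_one_of_letters TJ (BV := BV * (2 * (1 + 1 / ν)) ^ 3) (BD := BD * (2 * (1 + 1 / ν)) ^ 3) (C₁ := C₁ * (2 * (1 + 1 / ν)) ^ 3)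
    (C₂ := C₂ * (2 * (1 + 1 / ν)) ^ 3) (C₃ := C₃ * (2 * (1 + 1 / ν)) ^ 3) (CT := CT * (2 * (1 + 1 / ν)) ^ 3) (CTD := CTD * (2 * (1 + 1 / ν)) ^ 3) hδ U₀ hreg ha hp₀ hp₁
    (mul_nonneg hBV hV) (mul_nonneg hBD hV) (mul_nonneg hC₁ hV) (mul_nonneg hC₂ hV) (mul_nonneg hC₃ hV) (mul_nonneg hCT hV) (mul_nonneg hCTD hV)
    (fun z Y m hm hY bd => (hGw z Y m hm hY bd).trans (le_of_eq (by ring)))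
    (fun z Y m hm hY x => (hDw z Y m hm hY x).trans (le_of_eq (by ring)))
    (fun z v m hm hv y => (hc1w z v m hm hv y).trans (le_of_eq (by ring)))
    (fun z v m hm hv b => (hc2w z v m hm hv b).trans (le_of_eq (by ring)))
    (fun z v m hm hv y => (hc3w z v m hm hv y).trans (le_of_eq (by ring)))
    (fun z Y m hm hY bd => (hTw z Y m hm hY bd).trans (le_of_eq (by ring)))
    (fun z Y m hm hY x => (hTDw z Y m hm hY x).trans (le_of_eq (by ring)))
    hwin

end Rows

end Summit.QuantumFields.YangMills.Theorems.Prop7GreenOneMinusEtaBlockDecay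

end
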